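import Summits.BirchSwinnertonDyer.Rank1Residual.AdditivePotMult.QuadraticBaseChangeOddTamagawaSemistableTwo
import Summits.BirchSwinnertonDyer.Rank1Residual.Additive.CyclotomicThreeMultiplicativeReduction
import Summits.BirchSwinnertonDyer.Rank1Residual.Additive.CyclotomicThreeDescentData
import Literature.NumberTheory.DiophantineGeometry.PastenValuationProductsProofs
import Literature.NumberTheory.EllipticCurves.RootNumberProofs
import HarnessLib

/-!
# The odd part of Milne's quadratic BSD-quotient identity in the CANONICAL-MODEL currency `V ⊗ K`
# (cell `b2b-bsdres`, team n1011, seat p16 GEN 8; row T-MIL-CAN — the A73 / `C(V⊗K)` companion of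
# n1011-p01's row T-MIL-ODD, lead R5-74 (e))

HONEST FRAMING (cell `b2b-bsdres`, run/shared/lean/b2b/bsd-rank1-residual/, verbatim in every
file): the goal of the cell is to DELETE the COMBINATION-SHAPED residual classes of the
Birch–Swinnerton-Dyer formula for ALL analytic-rank `≤ 1` elliptic curves over `ℚ` — "full BSD
formula for every rank `≤ 1` curve in class `C`" assembled STRICTLY from published theorems — so
that the rank-`≤ 1` remainder becomes exactly the CONSTRUCTION-SHAPED classes, which are TYPED
(missing-input `Prop`s), NOT attempted. This is not "finishing BSD". Team n1011 (N10 / N11) and the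
`K = ℚ(ζ₃)`-side lines (V14, (S8)–(S10)): research routes; no claim beyond the stated classes;
X3 / X4 stay CONSTRUCTION-SHAPED; nothing is booked; no mark / label moved. TOOL theorems only: no
definition, no named fact, no `sorry`.

## What

The `K = ℚ(ζ₃)`-side class theorems of `Additive/` (`X3RankZeroCyclotomicThree`,
`XGordRankZero[One]CyclotomicThree[Lower]`, `XGordRankOne{Zero,One}CyclotomicThreeLowerK`, …) take
Milne's identity as the WHOLE named fact A73 `Milne1972.bsdQuotient_baseChange_quadratic_anyModel`
(`hMilne`), for the canonical model `V ⊗ K` and Dokchitser–Dokchitser's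
`C(V⊗K) = (V.baseChange K).modifiedTamagawaProduct` (no globally minimal `K`-model needed). What they
READ from it is (i) `Ш(V_K)` finite and (ii) the `p`-ADIC VALUATION of the identity of rationals
`C(V⊗K)·#Ш(V_K)·#V(ℚ)²·#W(ℚ)² = n_V·|u_C|·#Ш(V)·#Ш(W)·∏c(V)·∏c(W)·#V(K)²`
(`CyclotomicThreeDescentData.card_identity_baseChange`; rank-one shapes in
`CyclotomicThreeRankOne[One]TwistDescentData`). In (ii) the `Ш`- and torsion parts are tree
theorems at odd `p`; the ONLY input of A73 left is the Tamagawa–unit identity, which this file PROVES on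
n1011-p01's population S₁ of row T-MIL-ODD — `V/ℚ` globally minimal; `K` quadratic, `d_K` ODD
SQUAREFREE (e.g. `ℚ(ζ₃)`); `W = C • V^{(d_K)}` globally minimal; at every place `V` good, or
multiplicative, or the place divides `d_K` and `W` is multiplicative there (`hS`) — for every ODD `p`
at which `V` is good or multiplicative (FILE 2 then assembles (i) and (ii) themselves):

* §1 `padicValNat_tamagawaProduct_eq_add_of_sum_fibre` — the norm-free assembly schema: per-place
  identities `Σ_{w ∣ v} v_p(c_w(W')) = v_p(c_v(V)) + v_p(c_v(W))` at EVERY `v` give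
  `v_p ∏_w c_w(W') = v_p ∏c(V) + v_p ∏c(W)` (x11b's regrouping, any `K`);
* §2 on S₁: `padicValNat_tamagawaProduct_baseChange_eq_add_of_semistable` (fed by p01's MODEL-FREE
  per-place theorem `AdditivePotMult.sum_fibre_padicValNat_localTamagawaNumber_of_semistable'`),
  `padicValRat_abs_u_eq_zero_of_good_or_mult` (`v_p |u_C| = 0`, p01's FILE C-3c), and
  `padicValRat_modifiedTamagawaProduct_baseChange_eq_of_semistable`:
  **`v_p C(V⊗K) = v_p(|u_C| · ∏c(V) · ∏c(W))`** — p01's END #2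
  (`padicValRat_norm_mul_tamagawaProduct_eq_of_semistable'`, stated for a globally minimal `K`-model
  `W' = C' • V_K` with `|N(C'.u)|·∏c(W')`) in the canonical-model currency: `C(V⊗K)` replaces
  `|N(C'.u)|·∏c(W')`, no minimal `K`-model is needed (the tree has no existence theorem for one);
* §3 `population_of_squarefree_conductorNorm` — `hS` from `Squarefree (V.conductorNorm ℤ)` (the
  per-row certificate: Silverman *ATAEC* IV.10.2 via the tree's `isSemistable_iff_squarefree_conductorNorm`);
* FILE 2 (`QuadraticBaseChangeCardIdentityCanonicalModel`): `Ш(V_K)` finite and the `p`-adic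
  valuation of the card identity itself (rank `(0,0)` and any rank), from §2 and the tree's odd parts
  of `Ш` (Dokchitser–Dokchitser Lemma 4.14) and of the torsion (Silverman Ex. 10.16).

So for ord_p-consumers in the `V ⊗ K` currency the binder switch of lead R5-74 (e) is
`hMilne ↦ hS` on S₁ (p01's row T-MIL-ODD = A65 / minimal-model currency; this file = A73 /
canonical-model currency). HONEST LIMITS: S₁ × {`d_K` odd squarefree} × {`p` odd, `V` good or
multiplicative at `p`} only; the `2`-part and the real identity are NOT touched (Cassels–Tate /
local-index content of Milne's proof); the named fact A73 is NOT discharged (it quantifies over all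
data); closes no class; moves no mark. References: Milne, Invent. Math. 17 (1972) §1 Thm. 1;
T. and V. Dokchitser, Ann. of Math. 172 (2010) §1, §2.1, Lemma 4.14; Kramer, Trans. AMS 264 (1981) §2.
-/

noncomputable section

open scoped Classical NumberField

open WeierstrassCurve NumberField IsDedekindDomain Rat.HeightOneSpectrum WithZero
  Literature.NumberTheory.EllipticCurves Literature.NumberTheory.QuadraticFields
  Summit.BirchSwinnertonDyer.Rank1Residual.AdditivePotMult

namespace Summit.BirchSwinnertonDyer.Rank1Residual.Additive

/-! ## §1 The norm-free assembly schema -/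

section Assembly

/-- `ord_p` of a finite product of non-zero naturals is the sum of the `ord_p`. [folklore] -/
private theorem padicValNat_finsetProd' {ι : Type*} (p : ℕ) [Fact p.Prime] (s : Finset ι)
    (f : ι → ℕ) (hf : ∀ i ∈ s, f i ≠ 0) :
    padicValNat p (∏ i ∈ s, f i) = ∑ i ∈ s, padicValNat p (f i) := by
  classical
  induction s using Finset.induction_on with
  | empty => simp
  | insert a s ha ih =>
    rw [Finset.prod_insert ha, Finset.sum_insert ha,
      padicValNat.mul (hf a (Finset.mem_insert_self a s))
        (Finset.prod_ne_zero_iff.mpr fun i hi => hf i (Finset.mem_insert_of_mem hi)),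
      ih fun i hi => hf i (Finset.mem_insert_of_mem hi)]

/-- `ord_p |x| = ord_p x`. [folklore] -/
private theorem padicValRat_abs' (p : ℕ) (x : ℚ) : padicValRat p |x| = padicValRat p x := by
  rcases abs_choice x with h | h
  · rw [h]
  · rw [h, padicValRat.neg]

variable (V : WeierstrassCurve ℚ) [V.IsElliptic] (W : WeierstrassCurve ℚ) [W.IsElliptic]
  {K : Type} [Field K] [NumberField K] (W' : WeierstrassCurve K) [W'.IsElliptic]
  (p : ℕ) [Fact p.Prime]

/-- **The norm-free assembly schema.** For elliptic `V, W / ℚ` and `W' / K` (`K` any number field)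
and a prime `p`: if at EVERY finite place `v` of `ℚ` the local Tamagawa numbers satisfy
`Σ_{w ∣ v} v_p(c_w(W')) = v_p(c_v(V)) + v_p(c_v(W))` (fibres `{w : w ∩ 𝓞 ℚ = v}` as the `Finset`s of
the tree's `finite_setOf_under_eq_of_numberField`), then
`v_p ∏_w c_w(W') = v_p ∏_v c_v(V) + v_p ∏_v c_v(W)`. The three Tamagawa products are finite products
over the places (`mulSupport_localTamagawaNumber_finite_holds`); the `K`-side is regrouped along the
fibres of `w ↦ w ∩ 𝓞 ℚ` — verbatim the regrouping of x11b's `padicValNat_tamagawaProduct_baseChange_quadratic`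
(Jetchev–Skinner–Wan 2017 (eq:tamK)), the per-place identity abstracted into `hT`.
[cite: JetchevSkinnerWan2017, §7.3.1 (eq:tamK)] -/
theorem padicValNat_tamagawaProduct_eq_add_of_sum_fibre
    (hT : ∀ v : HeightOneSpectrum (𝓞 ℚ),
      ∑ w ∈ (HeightOneSpectrum.finite_setOf_under_eq_of_numberField (K := K) v).toFinset,
          padicValNat p ((W'.baseChange (w.adicCompletion K)).localTamagawaNumber
            (w.adicCompletionIntegers K)) =
        padicValNat p ((V.baseChange (v.adicCompletion ℚ)).localTamagawaNumber
            (v.adicCompletionIntegers ℚ)) +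
          padicValNat p ((W.baseChange (v.adicCompletion ℚ)).localTamagawaNumber
            (v.adicCompletionIntegers ℚ))) :
    padicValNat p W'.tamagawaProduct =
      padicValNat p V.tamagawaProduct + padicValNat p W.tamagawaProduct := by
  set cK : HeightOneSpectrum (𝓞 K) → ℕ := fun w =>
    (W'.baseChange (w.adicCompletion K)).localTamagawaNumber (w.adicCompletionIntegers K) with hcK
  set cQ : HeightOneSpectrum (𝓞 ℚ) → ℕ := fun v =>
    (V.baseChange (v.adicCompletion ℚ)).localTamagawaNumber (v.adicCompletionIntegers ℚ) with hcQ
  set cD : HeightOneSpectrum (𝓞 ℚ) → ℕ := fun v =>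
    (W.baseChange (v.adicCompletion ℚ)).localTamagawaNumber (v.adicCompletionIntegers ℚ) with hcD
  have hfinK : (Function.mulSupport cK).Finite := W'.mulSupport_localTamagawaNumber_finite_holds
  have hfinQ : (Function.mulSupport cQ).Finite := V.mulSupport_localTamagawaNumber_finite_holds
  have hfinD : (Function.mulSupport cD).Finite := W.mulSupport_localTamagawaNumber_finite_holds
  set F : HeightOneSpectrum (𝓞 ℚ) → Finset (HeightOneSpectrum (𝓞 K)) := fun v =>
    (HeightOneSpectrum.finite_setOf_under_eq_of_numberField (K := K) v).toFinset with hF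
  have hmemF : ∀ v w, w ∈ F v ↔ w.under (𝓞 ℚ) = v := fun v w => by
    simp [hF, Set.Finite.mem_toFinset]
  set SQ : Finset (HeightOneSpectrum (𝓞 ℚ)) :=
    hfinK.toFinset.image (fun w => w.under (𝓞 ℚ)) ∪ hfinQ.toFinset ∪ hfinD.toFinset with hSQ
  set SK : Finset (HeightOneSpectrum (𝓞 K)) := SQ.biUnion F with hSK
  have hsubK : Function.mulSupport cK ⊆ ↑SK := by
    intro w hw
    rw [Finset.mem_coe, hSK, Finset.mem_biUnion]
    refine ⟨w.under (𝓞 ℚ), ?_, (hmemF _ _).mpr rfl⟩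
    rw [hSQ, Finset.mem_union, Finset.mem_union, Finset.mem_image]
    exact Or.inl (Or.inl ⟨w, hfinK.mem_toFinset.mpr hw, rfl⟩)
  have hsubQ : Function.mulSupport cQ ⊆ ↑SQ := fun v hv => by
    rw [Finset.mem_coe, hSQ, Finset.mem_union, Finset.mem_union]
    exact Or.inl (Or.inr (hfinQ.mem_toFinset.mpr hv))
  have hsubD : Function.mulSupport cD ⊆ ↑SQ := fun v hv => by
    rw [Finset.mem_coe, hSQ, Finset.mem_union, Finset.mem_union]
    exact Or.inr (hfinD.mem_toFinset.mpr hv)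
  -- `ord_p` of the three products as sums over the index sets
  have hK' : padicValNat p W'.tamagawaProduct = ∑ w ∈ SK, padicValNat p (cK w) := by
    rw [show W'.tamagawaProduct = ∏ᶠ w, cK w from rfl, finprod_eq_prod_of_mulSupport_subset cK hsubK]
    exact padicValNat_finsetProd' p SK cK fun w _ => W'.localTamagawaNumber_baseChange_ne_zero w
  have hQ' : padicValNat p V.tamagawaProduct = ∑ v ∈ SQ, padicValNat p (cQ v) := by
    rw [show V.tamagawaProduct = ∏ᶠ v, cQ v from rfl, finprod_eq_prod_of_mulSupport_subset cQ hsubQ]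
    exact padicValNat_finsetProd' p SQ cQ fun v _ => V.localTamagawaNumber_baseChange_ne_zero v
  have hD' : padicValNat p W.tamagawaProduct = ∑ v ∈ SQ, padicValNat p (cD v) := by
    rw [show W.tamagawaProduct = ∏ᶠ v, cD v from rfl, finprod_eq_prod_of_mulSupport_subset cD hsubD]
    exact padicValNat_finsetProd' p SQ cD fun v _ => W.localTamagawaNumber_baseChange_ne_zero v
  -- regroup the `K`-side along the fibres
  have hmaps : ∀ w ∈ SK, w.under (𝓞 ℚ) ∈ SQ := by
    intro w hw
    rw [hSK, Finset.mem_biUnion] at hw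
    obtain ⟨v, hv, hwv⟩ := hw
    rwa [(hmemF v w).mp hwv]
  have hfib : ∀ v ∈ SQ, SK.filter (fun w => w.under (𝓞 ℚ) = v) = F v := by
    intro v hv
    ext w
    simp only [Finset.mem_filter, hmemF]
    constructor
    · exact fun h => h.2
    · intro h
      refine ⟨?_, h⟩
      rw [hSK, Finset.mem_biUnion]
      exact ⟨v, hv, (hmemF v w).mpr h⟩
  rw [hK', hQ', hD', ← Finset.sum_fiberwise_of_maps_to hmaps, ← Finset.sum_add_distrib]
  refine Finset.sum_congr rfl fun v hv => ?_
  rw [hfib v hv]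
  exact hT v

end Assembly

/-! ## §2 The Tamagawa–unit valuation identity on S₁, canonical-model currency -/

section CanonicalModel

variable (K : Type) [Field K] [NumberField K]
  (V : WeierstrassCurve ℚ) [V.IsElliptic] [V.IsGloballyMinimal]
  (W : WeierstrassCurve ℚ) [W.IsElliptic] [W.IsGloballyMinimal] (p : ℕ) [hp : Fact p.Prime]

/-- **`v_p ∏_w c_w(V_K) = v_p ∏c(V) + v_p ∏c(W)` on S₁** (`p` odd): `V/ℚ` globally minimal, `K`
quadratic with `d_K` odd squarefree, `W = C • V^{(d_K)}` globally minimal, and the population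
hypothesis `hS` of row T-MIL-ODD (at every place `V` is good, or multiplicative, or the place divides
`d_K` and `W` is multiplicative there). The schema of §1 fed with n1011-p01's per-place theorem
`AdditivePotMult.sum_fibre_padicValNat_localTamagawaNumber_of_semistable'` (model-free on the
`K`-side: it speaks of `c_w(V ⊗ K)`). Milne 1972 §1 / Kramer 1981 §2 Props. 1–3, place by place.
[cite: Milne1972ArithmeticAV, §1 Thm. 1 and §2 (through DokchitserDokchitserAnnals2010, §2.1, proof of Thm. 8)] -/
theorem padicValNat_tamagawaProduct_baseChange_eq_add_of_semistable (h2 : Module.finrank ℚ K = 2)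
    (hdodd : Odd (NumberField.discr K)) (hdsq : Squarefree (NumberField.discr K))
    {C : VariableChange ℚ} (hC : C • V.quadraticTwist (NumberField.discr K : ℚ) = W) (hp2 : p ≠ 2)
    (hS : ∀ v : HeightOneSpectrum (𝓞 ℚ), V.HasGoodReductionAt v ∨ V.HasMultiplicativeReductionAt v ∨
      (((primesEquiv v : ℕ) : ℤ) ∣ NumberField.discr K ∧ W.HasMultiplicativeReductionAt v)) :
    padicValNat p (V.baseChange K).tamagawaProduct =
      padicValNat p V.tamagawaProduct + padicValNat p W.tamagawaProduct := by
  haveI : (V.baseChange K).IsElliptic := by rw [baseChange]; infer_instance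
  exact padicValNat_tamagawaProduct_eq_add_of_sum_fibre V W (V.baseChange K) p fun v =>
    sum_fibre_padicValNat_localTamagawaNumber_of_semistable' V K W h2 hdodd hdsq hC p hp2 v (hS v)

/-- **`v_p |u_C| = 0` when `V` is good or multiplicative at `p`** (`p` odd; `W = C • V^{(d_K)}`, `d_K`
squarefree): the twist scaling unit is a `p`-adic unit — n1011-p01's FILE C-3c
`valuation_u_twist_eq_one_of_[not_]dvd_of_good / _of_mult` (`ord Δ_min` bookkeeping of the twist at a
good / multiplicative place, ramified or not), read additively (`padicValRat_eq_neg_log_valuation`).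
[cite: SilvermanAEC2009, VII.1 Prop. 1.3(a)] -/
theorem padicValRat_abs_u_eq_zero_of_good_or_mult (hdsq : Squarefree (NumberField.discr K))
    {C : VariableChange ℚ} (hC : C • V.quadraticTwist (NumberField.discr K : ℚ) = W) (hp2 : p ≠ 2)
    (h₀ : V.HasGoodReductionAtPrime p ∨ V.HasMultiplicativeReductionAtPrime p) :
    padicValRat p |(C.u : ℚ)| = 0 := by
  set v₀ : HeightOneSpectrum (𝓞 ℚ) := (primesEquiv (R := 𝓞 ℚ)).symm ⟨p, hp.out⟩ with hv₀def
  have hv₀ : primesEquiv v₀ = ⟨p, hp.out⟩ := by rw [hv₀def, Equiv.apply_symm_apply]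
  have hv₀' : (primesEquiv v₀ : ℕ) = p := by rw [hv₀]
  have hv₀2 : (primesEquiv v₀ : ℕ) ≠ 2 := by rw [hv₀']; exact hp2
  set d : ℤ := NumberField.discr K with hddef
  have hd0 : d ≠ 0 := NumberField.discr_ne_zero K
  have hd2 : ¬ ((primesEquiv v₀ : ℕ) : ℤ) ^ 2 ∣ d := not_sq_dvd_of_squarefree hdsq _ (primesEquiv v₀).2
  -- the place-indexed reduction type at `v₀`
  have h₀' : V.HasGoodReductionAt v₀ ∨ V.HasMultiplicativeReductionAt v₀ := by
    rcases h₀ with hg | hm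
    · left
      refine (hasGoodReductionAtPrime_iff_hasGoodReductionAt_ringOfIntegers v₀ V).mp ?_
      rw [hv₀]; exact hg
    · right
      refine (hasMultiplicativeReductionAtPrime_iff_hasMultiplicativeReductionAt_ringOfIntegers
        (W := V) v₀).mp ?_
      rw [hv₀]; exact hm
  have hval : v₀.valuation ℚ (C.u : ℚ) = 1 := by
    by_cases hdvd : ((primesEquiv v₀ : ℕ) : ℤ) ∣ d
    · rcases h₀' with hg | hm
      · exact valuation_u_twist_eq_one_of_dvd_of_good V W v₀ hv₀2 hdvd hd2 hC hg
      · exact valuation_u_twist_eq_one_of_dvd_of_mult V W v₀ hv₀2 hdvd hd2 hC hm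
    · rcases h₀' with hg | hm
      · exact valuation_u_twist_eq_one_of_not_dvd_of_good V W v₀ hv₀2 hd0 hdvd hC hg
      · exact valuation_u_twist_eq_one_of_not_dvd_of_mult V W v₀ hv₀2 hd0 hdvd hC hm
  rw [padicValRat_abs' p, ← hv₀', padicValRat_eq_neg_log_valuation v₀ (C.u).ne_zero, hval, log_one,
    neg_zero]

/-- **THE TAMAGAWA–UNIT IDENTITY OF MILNE'S QUOTIENT ON S₁, CANONICAL-MODEL CURRENCY:
`v_p C(V ⊗ K) = v_p(|u_C| · ∏c(V) · ∏c(W))`** for `V/ℚ` globally minimal, `K` quadratic with `d_K`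
odd squarefree, `W = C • V^{(d_K)}` globally minimal, the population hypothesis `hS`, and an odd
prime `p` at which `V` is good or multiplicative. This is n1011-p01's END #2
`AdditivePotMult.padicValRat_norm_mul_tamagawaProduct_eq_of_semistable'` (there for a globally minimal
`K`-model `W' = C' • V_K`, with `|N(C'.u)|·∏c(W')` on the left) in the currency of the `K = ℚ(ζ₃)`-side
files, where Dokchitser–Dokchitser's `C(V⊗K)` stands for `|N(C'.u)|·∏c(W')` and no minimal `K`-model is
needed: `v_p C(V⊗K) = v_p ∏_w c_w(V_K)` because `V ⊗ K` is minimal above `p` (tree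
`padicValRat_modifiedTamagawaProduct_baseChange[_of_mult]`), `v_p ∏_w c_w(V_K) = v_p ∏c(V) + v_p ∏c(W)`
(`padicValNat_tamagawaProduct_baseChange_eq_add_of_semistable`), `v_p|u_C| = 0`
(`padicValRat_abs_u_eq_zero_of_good_or_mult`).
[cite: Milne1972ArithmeticAV, §1 Thm. 1 and §2 (through DokchitserDokchitserAnnals2010, §2.1, proof of Thm. 8)]
[cite: DokchitserDokchitserAnnals2010, §1 Notation (arXiv pp. 4–5)] -/
theorem padicValRat_modifiedTamagawaProduct_baseChange_eq_of_semistable (h2 : Module.finrank ℚ K = 2)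
    (hdodd : Odd (NumberField.discr K)) (hdsq : Squarefree (NumberField.discr K))
    {C : VariableChange ℚ} (hC : C • V.quadraticTwist (NumberField.discr K : ℚ) = W) (hp2 : p ≠ 2)
    (hS : ∀ v : HeightOneSpectrum (𝓞 ℚ), V.HasGoodReductionAt v ∨ V.HasMultiplicativeReductionAt v ∨
      (((primesEquiv v : ℕ) : ℤ) ∣ NumberField.discr K ∧ W.HasMultiplicativeReductionAt v))
    (h₀ : V.HasGoodReductionAtPrime p ∨ V.HasMultiplicativeReductionAtPrime p) :
    padicValRat p (V.baseChange K).modifiedTamagawaProduct =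
      padicValRat p (|(C.u : ℚ)| * (V.tamagawaProduct * W.tamagawaProduct) : ℚ) := by
  have hM : padicValRat p (V.baseChange K).modifiedTamagawaProduct =
      padicValNat p (V.baseChange K).tamagawaProduct := by
    rcases h₀ with hg | hm
    · exact padicValRat_modifiedTamagawaProduct_baseChange V p
        (fun hdvd ↦ V.not_hasGoodReductionAtPrime_of_dvd_minimalDiscriminantInt p hdvd hg)
    · exact padicValRat_modifiedTamagawaProduct_baseChange_of_mult V p hm
  have hu : |(C.u : ℚ)| ≠ 0 := abs_ne_zero.mpr (C.u).ne_zero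
  have hcV : (V.tamagawaProduct : ℚ) ≠ 0 := by exact_mod_cast V.tamagawaProduct_pos'.ne'
  have hcW : (W.tamagawaProduct : ℚ) ≠ 0 := by exact_mod_cast W.tamagawaProduct_pos'.ne'
  rw [hM, padicValNat_tamagawaProduct_baseChange_eq_add_of_semistable K V W p h2 hdodd hdsq hC hp2 hS,
    padicValRat.mul hu (mul_ne_zero hcV hcW), padicValRat.mul hcV hcW,
    padicValRat_abs_u_eq_zero_of_good_or_mult K V W p hdsq hC hp2 h₀, padicValRat.of_nat,
    padicValRat.of_nat]
  push_cast
  ring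

end CanonicalModel

/-! ## §3 The population S₁ from a squarefree conductor -/

section Population

variable (K : Type) [Field K] [NumberField K] (V : WeierstrassCurve ℚ) [V.IsElliptic]
  (W : WeierstrassCurve ℚ)

/-- **The population hypothesis `hS` of row T-MIL-ODD from a SQUAREFREE CONDUCTOR**: if
`N_V = V.conductorNorm ℤ` is squarefree then `V` is semistable over the places of `ℤ` (tree
`isSemistable_iff_squarefree_conductorNorm`, Silverman *ATAEC* IV.10.2), hence over the places of
`𝓞 ℚ` (the two indexings of the finite places of `ℚ` carry the same reduction types, read on the
`ℤ_ℓ`-minimal model: tree bridges `hasGoodReductionAtPrime_primesEquiv_iff_hasGoodReductionAt`,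
`hasGoodReductionAtPrime_iff_hasGoodReductionAt_ringOfIntegers` and the multiplicative analogues — the
same passage as the tree's `Literature.NumberTheory.DiophantineGeometry.isSemistable_ringOfIntegers_of_isSemistable_int`,
inlined here to keep the import closure light), so at every place `V` is good or multiplicative — the
first two disjuncts of `hS`. This is the per-row certificate (a squarefree numeral) by which census rows
enter S₁. [cite: Silverman1994, IV.10.2] -/
theorem population_of_squarefree_conductorNorm (hN : Squarefree (V.conductorNorm ℤ)) :
    ∀ v : HeightOneSpectrum (𝓞 ℚ), V.HasGoodReductionAt v ∨ V.HasMultiplicativeReductionAt v ∨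
      (((primesEquiv v : ℕ) : ℤ) ∣ NumberField.discr K ∧ W.HasMultiplicativeReductionAt v) := by
  have hV : V.IsSemistable ℤ := (V.isSemistable_iff_squarefree_conductorNorm).mpr hN
  intro v
  set v' : HeightOneSpectrum ℤ := (primesEquiv (R := ℤ)).symm (primesEquiv v) with hv'def
  have hp : primesEquiv v' = primesEquiv v := by rw [hv'def, Equiv.apply_symm_apply]
  rcases hV v' with hg | hm
  · left
    have h := (V.hasGoodReductionAtPrime_primesEquiv_iff_hasGoodReductionAt v').mpr hg
    rw [hp] at h
    exact (hasGoodReductionAtPrime_iff_hasGoodReductionAt_ringOfIntegers v V).mp h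
  · right; left
    have h := (V.hasMultiplicativeReductionAtPrime_primesEquiv_iff_hasMultiplicativeReductionAt v').mpr hm
    rw [hp] at h
    exact (hasMultiplicativeReductionAtPrime_iff_hasMultiplicativeReductionAt_ringOfIntegers
      (W := V) v).mp h

/-- **`V` is good or multiplicative at every prime when `N_V` is squarefree** (prime-indexed form of
semistability, through the `ℤ`-indexed bridge `hasGoodReductionAtPrime_primesEquiv_iff_hasGoodReductionAt`
and its multiplicative analogue): the hypothesis `h₀` of §2 at the prime `p` from the same per-row
certificate. [cite: Silverman1994, IV.10.2] -/
theorem good_or_mult_atPrime_of_squarefree_conductorNorm (hN : Squarefree (V.conductorNorm ℤ))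
    (p : ℕ) [hp : Fact p.Prime] :
    V.HasGoodReductionAtPrime p ∨ V.HasMultiplicativeReductionAtPrime p := by
  have hV : V.IsSemistable ℤ := (V.isSemistable_iff_squarefree_conductorNorm).mpr hN
  set v' : HeightOneSpectrum ℤ := (primesEquiv (R := ℤ)).symm ⟨p, hp.out⟩ with hv'def
  have hp' : primesEquiv v' = ⟨p, hp.out⟩ := by rw [hv'def, Equiv.apply_symm_apply]
  rcases hV v' with hg | hm
  · left
    have h := (V.hasGoodReductionAtPrime_primesEquiv_iff_hasGoodReductionAt v').mpr hg
    rw [hp'] at h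
    exact h
  · right
    have h := (V.hasMultiplicativeReductionAtPrime_primesEquiv_iff_hasMultiplicativeReductionAt v').mpr hm
    rw [hp'] at h
    exact h

end Population

end Summit.BirchSwinnertonDyer.Rank1Residual.Additive

end
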